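import Summits.HodgeConjecture.HodgeConjecture.Theorems.Ring2WeilCoverageCMFieldInertPrimes
import Summits.HodgeConjecture.HodgeConjecture.Theorems.Ring2WeilCoverageCMFieldSquareClasses
import Summits.HodgeConjecture.HodgeConjecture.Theorems.Ring2WeilCoverageCMFieldBiquadratic
import HarnessLib

/-!
# Weil-type components over quartic CM fields, VI: the SPLIT entries of the census tables — explicit norm
# witnesses `X² - σY² = n·m²` in `ℤ[σ]` (part A: generic lemmas; `ℚ(ζ₅)`, `ℚ(ζ₈)`, `ℚ(ζ₁₂)`)

research route conditional on HC_CM; not a corollary; Q11.4-sentence-2 already refuted in dim ≥ 3.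
Cell `pub-hodge-ring2`, seat `ring2-b03` (gen 49); kernel certificates for the Weil-type family-coverage census
`HOME/WEIL-FAMILY-COVERAGE.md` §b03.5 (operator priority5 2026-08-22T11:46:08Z). Gens 46–48 decided in the kernel
every NON-SPLIT class `[n]`, `n ≤ 40`, of the seven tables (`[n] ≠ [1]` in `F^×/Nm_{E/F}(E^×)` on Deligne's
carriers `Deligne1982/WeilTypeCMDiscriminant`); the SPLIT entries (`[n] = [1]`, i.e. `n ∈ Nm_{E/F}(E^×)`: the
component `W8.E.[n]` IS the split one — it has an `E`-Lagrangian member, Deligne Cor. 4.2) were so far certified by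
computation only (PARI `rnfisnorm` + the disjoint stdlib code of §b03.5). This file and its part B
(`Ring2WeilCoverageCMFieldNormWitnessesB`) are their kernel form — the CM-field analogue of ring2-b04's `mem_a`
entries in `Ring2WeilCoverageNormTable`:

* §0 generic, on Deligne's carriers `F = ℚ[S]/(R)`, `E = ℚ[T]/(R(T²))`, `R = S² + pS + q`, `σ = S mod R`:
  `splitDiscriminantClassCM_two_eq_one` (`[(-1)²] = [1]`); `mk_mul_eq_splitDiscriminantClassCM_two` (products of
  split classes are split); `mk_eq_splitDiscriminantClassCM_two_of_normForm` (`a² - σb² = u·m²`, `m ≠ 0` ⟹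
  `[u] = [1]`: `u = Nm_{E/F}((a + bη)/m)`, `Deligne1982.algebraMap_norm_eq_mul_cmConj`); the INTEGER-COORDINATE form
  `mk_eq_splitDiscriminantClassCM_two_of_coords`: integers `A, B, C, D, m` (`m ≠ 0`) with
  `A² - qB² + 2qCD - pqD² = n·m²` and `2AB - pB² - C² + 2pCD - (p² - q)D² = 0` (the two coordinates of
  `(A + Bσ)² - σ(C + Dσ)²` on `ℤ ⊕ ℤσ`, `normForm_coords`) ⟹ `[n] = [1]`; and the packaging `…_of_coords_of_pos`
  supplying the field instance of `E` from `0 < p`, `4q < p²`, `p² - 4q` not a square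
  (`fact_irreducible_cmPolyQ_of_pos`) — every instance is ONE TERM over it, the two identities by `norm_num`.
* §1–§3 the instances for `ℚ(ζ₅)` (`R = S²+5S+5`): 5, 11, 31; `ℚ(ζ₈)` (`S²+6S+1`): 2, 3, 5, 11, 13, 17, 19, 29, 37;
  `ℚ(ζ₁₂)` (`S²+8S+4`): 2, 3, 5, 7, 13, 17, 19, 29, 31, 37 — EVERY PRIME `n ≤ 40` with `[n] = [1]` in those three
  tables of §b03.5 (part B: `ℚ(√-3,√5)`, `ℚ(i,√5)`, `ℚ(√-(2+√2))`, `ℚ(√-(3+√2))`). Squares and products of split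
  classes are split (§0, `sq_mem_normUnitsSubgroup_cmField`), so with gens 46–48 every entry `n ≤ 40` of these
  tables is decided in the kernel.

No named fact, no definition, no `sorry`; nothing about the Hodge conjecture is asserted: `[n] = [1]` says that the
component `W8.E.[n]` is the split one (Deligne Cor. 4.2), whose general member is OPEN like every other row's.
References: [Deligne1982HodgeCycles] §4 p. 30 (1), Cor. 4.2, Lemma 4.6; [Landherr1936HermitianForms]. -/

noncomputable section

set_option linter.dupNamespace false

open Polynomial

namespace Summit.HodgeConjecture.HodgeConjecture.Ring2.WeilCoverageCM

open Literature.AlgebraicGeometry.Deligne1982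
open Literature.AlgebraicGeometry.HodgeTheory (splitDiscriminantClassCM)

/-! ### §0 Generic: norm-form values times squares are norms -/

section Generic

variable {R : Polynomial ℤ} [Fact (Irreducible (realPolyQ R))]

/-- **The split class at `k = 2` is the identity**: `[(-1)²] = [1]` in `F^×/Nm_{E/F}(E^×)` (Deligne Cor. 4.2 (a),
`d/2 = 2`). [cite: Deligne1982HodgeCycles, §4 Cor. 4.2 (a)] -/
theorem splitDiscriminantClassCM_two_eq_one : splitDiscriminantClassCM R 2 = 1 := by
  rw [splitDiscriminantClassCM, neg_one_sq, QuotientGroup.mk_one]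

/-- **Products of split classes are split** (`[u₁] = [u₂] = [1] ⇒ [u₁u₂] = [1]`).
[cite: Deligne1982HodgeCycles, §4 p. 30] -/
theorem mk_mul_eq_splitDiscriminantClassCM_two (u₁ u₂ : (realField R)ˣ)
    (h₁ : (QuotientGroup.mk u₁ : cmNormResidueGroup R) = splitDiscriminantClassCM R 2)
    (h₂ : (QuotientGroup.mk u₂ : cmNormResidueGroup R) = splitDiscriminantClassCM R 2) :
    (QuotientGroup.mk (u₁ * u₂) : cmNormResidueGroup R) = splitDiscriminantClassCM R 2 := by
  rw [splitDiscriminantClassCM_two_eq_one, QuotientGroup.eq_one_iff] at h₁ h₂ ⊢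
  exact mul_mem h₁ h₂

/-- **`a² - σb² = u·m²`, `m ≠ 0` ⟹ `[u] = [1]`**: `u·m² = Nm_{E/F}(z)`, `z = a + bη`
(`Deligne1982.algebraMap_norm_eq_mul_cmConj`, `norm_coords`), and `m² = Nm_{E/F}(m)`, so `u ∈ Nm_{E/F}(E^×)`, i.e.
`[u]` is the split class `[(-1)²]`. [cite: Deligne1982HodgeCycles, §4 p. 30 (1) and Cor. 4.2] -/
theorem mk_eq_splitDiscriminantClassCM_two_of_normForm [Fact (Irreducible (cmPolyQ R))] (u : (realField R)ˣ)
    (a b m : realField R) (hm : m ≠ 0) (h : a ^ 2 - AdjoinRoot.root (realPolyQ R) * b ^ 2 = u * m ^ 2) :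
    (QuotientGroup.mk u : cmNormResidueGroup R) = splitDiscriminantClassCM R 2 := by
  set v : (realField R)ˣ := Units.mk0 m hm with hv
  set z : cmField R := realToCM R a + realToCM R b * cmRoot R with hz
  have hnorm : Algebra.norm (realField R) z = ((u * v ^ 2 : (realField R)ˣ) : realField R) := by
    apply (realToCM R).injective
    rw [← algebraMap_realField_eq, algebraMap_norm_eq_mul_cmConj, algebraMap_realField_eq, hz, norm_coords, h,
      Units.val_mul, Units.val_pow_eq_pow_val, hv, Units.val_mk0]
  have hz0 : z ≠ 0 := by
    intro h0
    apply (u * v ^ 2).ne_zero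
    rw [← hnorm, h0, Algebra.norm_zero]
  have hmem : u * v ^ 2 ∈ Literature.AlgebraicGeometry.Motives.normUnitsSubgroup (realField R) (cmField R) :=
    Literature.AlgebraicGeometry.Motives.mem_normUnitsSubgroup_iff.2 ⟨Units.mk0 z hz0, by rw [Units.val_mk0, hnorm]⟩
  have hu : u = (u * v ^ 2) * (v ^ 2)⁻¹ := by rw [mul_inv_cancel_right]
  rw [splitDiscriminantClassCM_two_eq_one, QuotientGroup.eq_one_iff, hu]
  exact mul_mem hmem (inv_mem (sq_mem_normUnitsSubgroup_cmField v))

/-- **Integer-coordinate norm witness.** For `R = S² + pS + q` and integers `A, B, C, D, m` (`m ≠ 0`) with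
`A² - qB² + 2qCD - pqD² = n·m²` and `2AB - pB² - C² + 2pCD - (p² - q)D² = 0` — the two coordinates of
`(A + Bσ)² - σ(C + Dσ)² ∈ ℤ ⊕ ℤσ` (`normForm_coords`) — one has `(A + Bσ)² - σ(C + Dσ)² = n·m²`, hence
`[n] = [1]` in `F^×/Nm_{E/F}(E^×)`: the component `W8.E.[n]` is the SPLIT one.
[cite: Deligne1982HodgeCycles, §4 p. 30 (1) and Cor. 4.2] -/
theorem mk_eq_splitDiscriminantClassCM_two_of_coords [Fact (Irreducible (cmPolyQ R))] {p q : ℤ}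
    (hR : R = X ^ 2 + C p * X + C q) (n A B Cc D m : ℤ) (hm : m ≠ 0)
    (hX : A ^ 2 - q * B ^ 2 + 2 * q * Cc * D - p * q * D ^ 2 = n * m ^ 2)
    (hY : 2 * A * B - p * B ^ 2 - Cc ^ 2 + 2 * p * Cc * D - (p ^ 2 - q) * D ^ 2 = 0)
    (u : (realField R)ˣ) (hu : (u : realField R) = AdjoinRoot.of (realPolyQ R) n) :
    (QuotientGroup.mk u : cmNormResidueGroup R) = splitDiscriminantClassCM R 2 := by
  have key := normForm_coords hR (A : ℚ) (B : ℚ) (Cc : ℚ) (D : ℚ)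
  have hXq : (A : ℚ) ^ 2 - q * (B : ℚ) ^ 2 + 2 * q * (Cc : ℚ) * D - p * q * (D : ℚ) ^ 2 = n * (m : ℚ) ^ 2 := by
    exact_mod_cast hX
  have hYq : 2 * (A : ℚ) * B - p * (B : ℚ) ^ 2 - (Cc : ℚ) ^ 2 + 2 * p * (Cc : ℚ) * D
      - ((p : ℚ) ^ 2 - q) * (D : ℚ) ^ 2 = 0 := by
    exact_mod_cast hY
  rw [hXq, hYq, map_zero, zero_mul, add_zero, map_mul, map_pow] at key
  have hm' : AdjoinRoot.of (realPolyQ R) (m : ℚ) ≠ 0 := by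
    rw [Ne, map_eq_zero_iff _ (AdjoinRoot.of (realPolyQ R)).injective]
    exact_mod_cast hm
  refine mk_eq_splitDiscriminantClassCM_two_of_normForm u
    (AdjoinRoot.of (realPolyQ R) A + AdjoinRoot.of (realPolyQ R) B * AdjoinRoot.root (realPolyQ R))
    (AdjoinRoot.of (realPolyQ R) Cc + AdjoinRoot.of (realPolyQ R) D * AdjoinRoot.root (realPolyQ R)) _ hm' ?_
  rw [key, hu]

/-- **Packaged form** for `0 < p`, `4q < p²`, `p² - 4q` not a rational square (then `R(T²) = T⁴ + pT² + q` is
irreducible, `fact_irreducible_cmPolyQ_of_pos`, i.e. `E` is a field — all seven census fields): the integer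
witness `(A, B, C, D, m)` gives `[n] = [1]`. [cite: Deligne1982HodgeCycles, §4 p. 30 (1) and Cor. 4.2] -/
theorem mk_eq_splitDiscriminantClassCM_two_of_coords_of_pos {p q : ℤ} (hR : R = X ^ 2 + C p * X + C q)
    (hp : 0 < p) (h4 : 4 * q < p ^ 2) (hD : ∀ r : ℚ, r ^ 2 ≠ (p : ℚ) ^ 2 - 4 * q) (n A B Cc D m : ℤ) (hm : m ≠ 0)
    (hX : A ^ 2 - q * B ^ 2 + 2 * q * Cc * D - p * q * D ^ 2 = n * m ^ 2)
    (hY : 2 * A * B - p * B ^ 2 - Cc ^ 2 + 2 * p * Cc * D - (p ^ 2 - q) * D ^ 2 = 0)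
    (u : (realField R)ˣ) (hu : (u : realField R) = AdjoinRoot.of (realPolyQ R) n) :
    (QuotientGroup.mk u : cmNormResidueGroup R) = splitDiscriminantClassCM R 2 :=
  haveI := fact_irreducible_cmPolyQ_of_pos hR hp h4 hD
  mk_eq_splitDiscriminantClassCM_two_of_coords hR n A B Cc D m hm hX hY u hu

end Generic

/-! ### §1 `E = ℚ(ζ₅)`, `R = S² + 5S + 5` (`σ = -(5+√5)/2`): the primes `5, 11, 31` -/

section Zeta5

variable {R : Polynomial ℤ} (hR : R = X ^ 2 + C 5 * X + C 5) [Fact (Irreducible (realPolyQ R))]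
  (u : (realField R)ˣ)
include hR

/-- **`[5] = [1]` for `ℚ(ζ₅)`**: `5 = (5 + 2σ)²` (`5 + 2σ = ±√5`).
[cite: Deligne1982HodgeCycles, §4 p. 30 (1) and Cor. 4.2] -/
theorem zeta5_mk_five_eq_splitDiscriminantClassCM
    (hu : (u : realField R) = AdjoinRoot.of (realPolyQ R) 5) :
    (QuotientGroup.mk u : cmNormResidueGroup R) = splitDiscriminantClassCM R 2 :=
  mk_eq_splitDiscriminantClassCM_two_of_coords_of_pos hR (by norm_num) (by norm_num) disc_not_sq_five_five
    5 5 2 0 0 1 one_ne_zero (by norm_num) (by norm_num) u hu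

/-- **`[11] = [1]` for `ℚ(ζ₅)`**: `11 = (4 + 2σ)² - σ(4 + σ)²`.
[cite: Deligne1982HodgeCycles, §4 p. 30 (1) and Cor. 4.2] -/
theorem zeta5_mk_eleven_eq_splitDiscriminantClassCM
    (hu : (u : realField R) = AdjoinRoot.of (realPolyQ R) 11) :
    (QuotientGroup.mk u : cmNormResidueGroup R) = splitDiscriminantClassCM R 2 :=
  mk_eq_splitDiscriminantClassCM_two_of_coords_of_pos hR (by norm_num) (by norm_num) disc_not_sq_five_five
    11 4 2 4 1 1 one_ne_zero (by norm_num) (by norm_num) u hu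

/-- **`[31] = [1]` for `ℚ(ζ₅)`**: `31 = (4 + 2σ)² - σ(6 + σ)²`.
[cite: Deligne1982HodgeCycles, §4 p. 30 (1) and Cor. 4.2] -/
theorem zeta5_mk_thirtyOne_eq_splitDiscriminantClassCM
    (hu : (u : realField R) = AdjoinRoot.of (realPolyQ R) 31) :
    (QuotientGroup.mk u : cmNormResidueGroup R) = splitDiscriminantClassCM R 2 :=
  mk_eq_splitDiscriminantClassCM_two_of_coords_of_pos hR (by norm_num) (by norm_num) disc_not_sq_five_five
    31 4 2 6 1 1 one_ne_zero (by norm_num) (by norm_num) u hu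

end Zeta5

/-! ### §2 `E = ℚ(ζ₈) = ℚ(i,√2)`, `R = S² + 6S + 1` (`σ = -(3+2√2)`): the primes `2, 3, 5, 11, 13, 17, 19, 29, 37` -/

section Zeta8

variable {R : Polynomial ℤ} (hR : R = X ^ 2 + C 6 * X + C 1) [Fact (Irreducible (realPolyQ R))]
  (u : (realField R)ˣ)
include hR

/-- **`[2] = [1]` for `ℚ(ζ₈)`**: `2·2² = (3 + σ)²` (`3 + σ = -2√2`).
[cite: Deligne1982HodgeCycles, §4 p. 30 (1) and Cor. 4.2] -/
theorem zeta8_mk_two_eq_splitDiscriminantClassCM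
    (hu : (u : realField R) = AdjoinRoot.of (realPolyQ R) 2) :
    (QuotientGroup.mk u : cmNormResidueGroup R) = splitDiscriminantClassCM R 2 :=
  mk_eq_splitDiscriminantClassCM_two_of_coords_of_pos hR (by norm_num) (by norm_num) disc_not_sq_six_one
    2 3 1 0 0 2 two_ne_zero (by norm_num) (by norm_num) u hu

/-- **`[3] = [1]` for `ℚ(ζ₈)`**: `3·2² = (3 + σ)² - σ(5 + σ)²` (the census's `3 = 1 + (√2)²`).
[cite: Deligne1982HodgeCycles, §4 p. 30 (1) and Cor. 4.2] -/
theorem zeta8_mk_three_eq_splitDiscriminantClassCM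
    (hu : (u : realField R) = AdjoinRoot.of (realPolyQ R) 3) :
    (QuotientGroup.mk u : cmNormResidueGroup R) = splitDiscriminantClassCM R 2 :=
  mk_eq_splitDiscriminantClassCM_two_of_coords_of_pos hR (by norm_num) (by norm_num) disc_not_sq_six_one
    3 3 1 5 1 2 two_ne_zero (by norm_num) (by norm_num) u hu

/-- **`[5] = [1]` for `ℚ(ζ₈)`**: `5 = 1 - σ(5 + σ)²`. [cite: Deligne1982HodgeCycles, §4 p. 30 (1) and Cor. 4.2] -/
theorem zeta8_mk_five_eq_splitDiscriminantClassCM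
    (hu : (u : realField R) = AdjoinRoot.of (realPolyQ R) 5) :
    (QuotientGroup.mk u : cmNormResidueGroup R) = splitDiscriminantClassCM R 2 :=
  mk_eq_splitDiscriminantClassCM_two_of_coords_of_pos hR (by norm_num) (by norm_num) disc_not_sq_six_one
    5 1 0 5 1 1 one_ne_zero (by norm_num) (by norm_num) u hu

/-- **`[11] = [1]` for `ℚ(ζ₈)`**: `11·2² = 6² - σ(7 + σ)²`.
[cite: Deligne1982HodgeCycles, §4 p. 30 (1) and Cor. 4.2] -/
theorem zeta8_mk_eleven_eq_splitDiscriminantClassCM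
    (hu : (u : realField R) = AdjoinRoot.of (realPolyQ R) 11) :
    (QuotientGroup.mk u : cmNormResidueGroup R) = splitDiscriminantClassCM R 2 :=
  mk_eq_splitDiscriminantClassCM_two_of_coords_of_pos hR (by norm_num) (by norm_num) disc_not_sq_six_one
    11 6 0 7 1 2 two_ne_zero (by norm_num) (by norm_num) u hu

/-- **`[13] = [1]` for `ℚ(ζ₈)`**: `13 = 3² - σ(5 + σ)²`. [cite: Deligne1982HodgeCycles, §4 p. 30 (1) and Cor. 4.2] -/
theorem zeta8_mk_thirteen_eq_splitDiscriminantClassCM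
    (hu : (u : realField R) = AdjoinRoot.of (realPolyQ R) 13) :
    (QuotientGroup.mk u : cmNormResidueGroup R) = splitDiscriminantClassCM R 2 :=
  mk_eq_splitDiscriminantClassCM_two_of_coords_of_pos hR (by norm_num) (by norm_num) disc_not_sq_six_one
    13 3 0 5 1 1 one_ne_zero (by norm_num) (by norm_num) u hu

/-- **`[17] = [1]` for `ℚ(ζ₈)`**: `17 = 3² - σ(7 + σ)²`. [cite: Deligne1982HodgeCycles, §4 p. 30 (1) and Cor. 4.2] -/
theorem zeta8_mk_seventeen_eq_splitDiscriminantClassCM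
    (hu : (u : realField R) = AdjoinRoot.of (realPolyQ R) 17) :
    (QuotientGroup.mk u : cmNormResidueGroup R) = splitDiscriminantClassCM R 2 :=
  mk_eq_splitDiscriminantClassCM_two_of_coords_of_pos hR (by norm_num) (by norm_num) disc_not_sq_six_one
    17 3 0 7 1 1 one_ne_zero (by norm_num) (by norm_num) u hu

/-- **`[19] = [1]` for `ℚ(ζ₈)`**: `19·2² = (9 + 3σ)² - σ(5 + σ)²`.
[cite: Deligne1982HodgeCycles, §4 p. 30 (1) and Cor. 4.2] -/
theorem zeta8_mk_nineteen_eq_splitDiscriminantClassCM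
    (hu : (u : realField R) = AdjoinRoot.of (realPolyQ R) 19) :
    (QuotientGroup.mk u : cmNormResidueGroup R) = splitDiscriminantClassCM R 2 :=
  mk_eq_splitDiscriminantClassCM_two_of_coords_of_pos hR (by norm_num) (by norm_num) disc_not_sq_six_one
    19 9 3 5 1 2 two_ne_zero (by norm_num) (by norm_num) u hu

/-- **`[29] = [1]` for `ℚ(ζ₈)`**: `29 = 5² - σ(5 + σ)²`. [cite: Deligne1982HodgeCycles, §4 p. 30 (1) and Cor. 4.2] -/
theorem zeta8_mk_twentyNine_eq_splitDiscriminantClassCM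
    (hu : (u : realField R) = AdjoinRoot.of (realPolyQ R) 29) :
    (QuotientGroup.mk u : cmNormResidueGroup R) = splitDiscriminantClassCM R 2 :=
  mk_eq_splitDiscriminantClassCM_two_of_coords_of_pos hR (by norm_num) (by norm_num) disc_not_sq_six_one
    29 5 0 5 1 1 one_ne_zero (by norm_num) (by norm_num) u hu

/-- **`[37] = [1]` for `ℚ(ζ₈)`**: `37·2² = 12² - σ(5 + σ)²`.
[cite: Deligne1982HodgeCycles, §4 p. 30 (1) and Cor. 4.2] -/
theorem zeta8_mk_thirtySeven_eq_splitDiscriminantClassCM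
    (hu : (u : realField R) = AdjoinRoot.of (realPolyQ R) 37) :
    (QuotientGroup.mk u : cmNormResidueGroup R) = splitDiscriminantClassCM R 2 :=
  mk_eq_splitDiscriminantClassCM_two_of_coords_of_pos hR (by norm_num) (by norm_num) disc_not_sq_six_one
    37 12 0 5 1 2 two_ne_zero (by norm_num) (by norm_num) u hu

end Zeta8

/-! ### §3 `E = ℚ(ζ₁₂) = ℚ(i,√3)`, `R = S² + 8S + 4` (`σ = -(4+2√3)`): primes `2, 3, 5, 7, 13, 17, 19, 29, 31, 37` -/

section Zeta12

variable {R : Polynomial ℤ} (hR : R = X ^ 2 + C 8 * X + C 4) [Fact (Irreducible (realPolyQ R))]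
  (u : (realField R)ˣ)
include hR

/-- **`[2] = [1]` for `ℚ(ζ₁₂)`**: `2·4² = (6 + σ)² - σ·2²`.
[cite: Deligne1982HodgeCycles, §4 p. 30 (1) and Cor. 4.2] -/
theorem zeta12_mk_two_eq_splitDiscriminantClassCM
    (hu : (u : realField R) = AdjoinRoot.of (realPolyQ R) 2) :
    (QuotientGroup.mk u : cmNormResidueGroup R) = splitDiscriminantClassCM R 2 :=
  mk_eq_splitDiscriminantClassCM_two_of_coords_of_pos hR (by norm_num) (by norm_num) disc_not_sq_eight_four
    2 6 1 2 0 4 four_ne_zero (by norm_num) (by norm_num) u hu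

/-- **`[3] = [1]` for `ℚ(ζ₁₂)`**: `3·2² = (4 + σ)²` (`4 + σ = -2√3`).
[cite: Deligne1982HodgeCycles, §4 p. 30 (1) and Cor. 4.2] -/
theorem zeta12_mk_three_eq_splitDiscriminantClassCM
    (hu : (u : realField R) = AdjoinRoot.of (realPolyQ R) 3) :
    (QuotientGroup.mk u : cmNormResidueGroup R) = splitDiscriminantClassCM R 2 :=
  mk_eq_splitDiscriminantClassCM_two_of_coords_of_pos hR (by norm_num) (by norm_num) disc_not_sq_eight_four
    3 4 1 0 0 2 two_ne_zero (by norm_num) (by norm_num) u hu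

/-- **`[5] = [1]` for `ℚ(ζ₁₂)`**: `5·2² = 2² - σ(6 + σ)²`.
[cite: Deligne1982HodgeCycles, §4 p. 30 (1) and Cor. 4.2] -/
theorem zeta12_mk_five_eq_splitDiscriminantClassCM
    (hu : (u : realField R) = AdjoinRoot.of (realPolyQ R) 5) :
    (QuotientGroup.mk u : cmNormResidueGroup R) = splitDiscriminantClassCM R 2 :=
  mk_eq_splitDiscriminantClassCM_two_of_coords_of_pos hR (by norm_num) (by norm_num) disc_not_sq_eight_four
    5 2 0 6 1 2 two_ne_zero (by norm_num) (by norm_num) u hu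

/-- **`[7] = [1]` for `ℚ(ζ₁₂)`**: `7·2² = (4 + σ)² - σ(6 + σ)²`.
[cite: Deligne1982HodgeCycles, §4 p. 30 (1) and Cor. 4.2] -/
theorem zeta12_mk_seven_eq_splitDiscriminantClassCM
    (hu : (u : realField R) = AdjoinRoot.of (realPolyQ R) 7) :
    (QuotientGroup.mk u : cmNormResidueGroup R) = splitDiscriminantClassCM R 2 :=
  mk_eq_splitDiscriminantClassCM_two_of_coords_of_pos hR (by norm_num) (by norm_num) disc_not_sq_eight_four
    7 4 1 6 1 2 two_ne_zero (by norm_num) (by norm_num) u hu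

/-- **`[13] = [1]` for `ℚ(ζ₁₂)`**: `13·2² = 6² - σ(6 + σ)²`.
[cite: Deligne1982HodgeCycles, §4 p. 30 (1) and Cor. 4.2] -/
theorem zeta12_mk_thirteen_eq_splitDiscriminantClassCM
    (hu : (u : realField R) = AdjoinRoot.of (realPolyQ R) 13) :
    (QuotientGroup.mk u : cmNormResidueGroup R) = splitDiscriminantClassCM R 2 :=
  mk_eq_splitDiscriminantClassCM_two_of_coords_of_pos hR (by norm_num) (by norm_num) disc_not_sq_eight_four
    13 6 0 6 1 2 two_ne_zero (by norm_num) (by norm_num) u hu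

/-- **`[17] = [1]` for `ℚ(ζ₁₂)`**: `17 = 1 - σ(6 + σ)²`. [cite: Deligne1982HodgeCycles, §4 p. 30 (1) and Cor. 4.2] -/
theorem zeta12_mk_seventeen_eq_splitDiscriminantClassCM
    (hu : (u : realField R) = AdjoinRoot.of (realPolyQ R) 17) :
    (QuotientGroup.mk u : cmNormResidueGroup R) = splitDiscriminantClassCM R 2 :=
  mk_eq_splitDiscriminantClassCM_two_of_coords_of_pos hR (by norm_num) (by norm_num) disc_not_sq_eight_four
    17 1 0 6 1 1 one_ne_zero (by norm_num) (by norm_num) u hu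

/-- **`[19] = [1]` for `ℚ(ζ₁₂)`**: `19·2² = (4 + σ)² - σ(12 + 2σ)²`.
[cite: Deligne1982HodgeCycles, §4 p. 30 (1) and Cor. 4.2] -/
theorem zeta12_mk_nineteen_eq_splitDiscriminantClassCM
    (hu : (u : realField R) = AdjoinRoot.of (realPolyQ R) 19) :
    (QuotientGroup.mk u : cmNormResidueGroup R) = splitDiscriminantClassCM R 2 :=
  mk_eq_splitDiscriminantClassCM_two_of_coords_of_pos hR (by norm_num) (by norm_num) disc_not_sq_eight_four
    19 4 1 12 2 2 two_ne_zero (by norm_num) (by norm_num) u hu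

/-- **`[29] = [1]` for `ℚ(ζ₁₂)`**: `29·2² = 10² - σ(6 + σ)²`.
[cite: Deligne1982HodgeCycles, §4 p. 30 (1) and Cor. 4.2] -/
theorem zeta12_mk_twentyNine_eq_splitDiscriminantClassCM
    (hu : (u : realField R) = AdjoinRoot.of (realPolyQ R) 29) :
    (QuotientGroup.mk u : cmNormResidueGroup R) = splitDiscriminantClassCM R 2 :=
  mk_eq_splitDiscriminantClassCM_two_of_coords_of_pos hR (by norm_num) (by norm_num) disc_not_sq_eight_four
    29 10 0 6 1 2 two_ne_zero (by norm_num) (by norm_num) u hu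

/-- **`[31] = [1]` for `ℚ(ζ₁₂)`**: `31·2² = (12 + 3σ)² - σ(6 + σ)²`.
[cite: Deligne1982HodgeCycles, §4 p. 30 (1) and Cor. 4.2] -/
theorem zeta12_mk_thirtyOne_eq_splitDiscriminantClassCM
    (hu : (u : realField R) = AdjoinRoot.of (realPolyQ R) 31) :
    (QuotientGroup.mk u : cmNormResidueGroup R) = splitDiscriminantClassCM R 2 :=
  mk_eq_splitDiscriminantClassCM_two_of_coords_of_pos hR (by norm_num) (by norm_num) disc_not_sq_eight_four
    31 12 3 6 1 2 two_ne_zero (by norm_num) (by norm_num) u hu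

/-- **`[37] = [1]` for `ℚ(ζ₁₂)`**: `37·2² = 10² - σ(10 + σ)²`.
[cite: Deligne1982HodgeCycles, §4 p. 30 (1) and Cor. 4.2] -/
theorem zeta12_mk_thirtySeven_eq_splitDiscriminantClassCM
    (hu : (u : realField R) = AdjoinRoot.of (realPolyQ R) 37) :
    (QuotientGroup.mk u : cmNormResidueGroup R) = splitDiscriminantClassCM R 2 :=
  mk_eq_splitDiscriminantClassCM_two_of_coords_of_pos hR (by norm_num) (by norm_num) disc_not_sq_eight_four
    37 10 0 10 1 2 two_ne_zero (by norm_num) (by norm_num) u hu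

end Zeta12

end Summit.HodgeConjecture.HodgeConjecture.Ring2.WeilCoverageCM

end
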